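import Summits.ValiantsHypothesis.ValiantsHypothesis.Theorems.DivisionGapPerDivisionHardStubSparseRigidCount
import Summits.ValiantsHypothesis.ValiantsHypothesis.Theorems.DivisionGapDefs

/-!
# Crux `DivisionGap.PerDivisionHard` (stmt-ValiantsHypothesis-5065), line `pair-descent-jss-endpoint` —
stub `stub_greedyRows`: the greedy placement of column mode

`stub_greedyRows`: let `S` be a set of `b + b·(b·k)` columns each with more than `b + b·(b·k)`
cells in `Y` and more than `b + b·(b·k)` cells outside `Y`, and `n = b + b·(b·k) + m`.  Then some
placement `eR eC : BlockV b k m ≃ Fin n` of `G(b,k) ⊕ M₀` has its core and internal COLUMN labels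
in `S` and, for every path `(i, j)` and every `t + 1 < k`, the two cells of the internal column
`(i, j, t+1)` lying in the rows `(i, j, t)` and `(i, j, t+1)` are SPLIT by `Y` (exactly one of them
in `Y`).

Proof.  Columns: `exists_blockEquiv` (`StubSparseRigidCount.lean`).  Rows: `exists_greedySeq` —
a sequence `f : ℕ → α` with `f 0, …, f N` pairwise distinct and `f (s+1) ∈ good s (f s)` exists as
soon as `|good s a| > s + 1` (induction on `N`, `Finset.exists_mem_notMem_of_card_lt_card`,
`Function.update`).  The internal labels `(i, j, t)` are enumerated by `t + k·(j + b·i)`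
(`finProdFinEquiv` twice), so `(i, j, t+1)` is the successor of `(i, j, t)`; the good set at an
index whose successor decodes to the label `q` is the set of rows whose cell in the column of `q`
has the colour opposite to that of the previous row — it has more than `b + b·(b·k) ≥ b·b·k`
elements because the column lies in `S`.  The resulting injective map `ρ` on the internal labels
is extended to `eR : BlockV b k m ≃ Fin n` by `Equiv.ofInjective` (internal labels onto the image
of `ρ`), `Fintype.equivOfCardEq` (core and padding labels onto its complement) and
`Equiv.sumCompl`.
-/

noncomputable section

-- `Summit.ValiantsHypothesis.ValiantsHypothesis.…` is the tree's mandated single-conjunct layout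
-- (Sub = Summit), so the duplicated namespace component is intended.
set_option linter.dupNamespace false

namespace Summit.ValiantsHypothesis.ValiantsHypothesis.Theorems.DivisionGapPerDivisionHard

/-- **Greedy sequences.**  If every "good set" `good s a` has more than `s + 1` elements
(`s < N`), there is a sequence `f : ℕ → α` whose first `N + 1` values are pairwise distinct and
which steps inside the good sets: `f (s + 1) ∈ good s (f s)` for `s < N`. [folklore] -/
theorem exists_greedySeq {α : Type*} [DecidableEq α] [Nonempty α] (good : ℕ → α → Finset α) :
    ∀ N : ℕ, (∀ s < N, ∀ a, s + 1 < (good s a).card) →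
      ∃ f : ℕ → α, (∀ s ≤ N, ∀ s' < s, f s' ≠ f s) ∧ ∀ s < N, f (s + 1) ∈ good s (f s) := by
  intro N
  induction N with
  | zero =>
    intro _
    exact ⟨fun _ => Classical.arbitrary α, fun s hs s' hs' => absurd hs' (by omega),
      fun s hs => absurd hs (Nat.not_lt_zero s)⟩
  | succ N ih =>
    intro hgood
    obtain ⟨f, hinj, hf⟩ := ih fun s hs a => hgood s (Nat.lt_succ_of_lt hs) a
    have hlt : ((Finset.range (N + 1)).image f).card < (good N (f N)).card :=
      Finset.card_image_le.trans_lt (by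
        rw [Finset.card_range]; exact hgood N (Nat.lt_succ_self N) (f N))
    obtain ⟨v, hv, hvu⟩ := Finset.exists_mem_notMem_of_card_lt_card hlt
    refine ⟨Function.update f (N + 1) v, fun s hs s' hs' => ?_, fun s hs => ?_⟩
    · rcases Nat.lt_or_eq_of_le hs with hs | rfl
      · rw [Function.update_of_ne (by omega), Function.update_of_ne (by omega)]
        exact hinj s (Nat.lt_succ_iff.1 hs) s' hs'
      · rw [Function.update_self, Function.update_of_ne (by omega)]
        exact fun h => hvu (h ▸ Finset.mem_image_of_mem f (Finset.mem_range.2 hs'))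
    · rcases Nat.lt_or_eq_of_le (Nat.lt_succ_iff.1 hs) with hs | rfl
      · rw [Function.update_of_ne (by omega), Function.update_of_ne (by omega)]
        exact hf s hs
      · rw [Function.update_self, Function.update_of_ne (by omega)]
        exact hv

/-- **Extending an injection on the internal labels to a labelling.**  An injective map `ρ` of
the internal labels `Fin b × Fin b × Fin k` into `Fin n`, `b + b·(b·k) + m = n`, extends to a
bijection `eR : BlockV b k m ≃ Fin n` (`eR (Sum.inr (Sum.inl q)) = ρ q`). [folklore] -/
theorem exists_blockEquiv_extend {b k m n : ℕ} (ρ : Fin b × Fin b × Fin k → Fin n)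
    (hρ : Function.Injective ρ) (hn : b + b * (b * k) + m = n) :
    ∃ eR : BlockV b k m ≃ Fin n, ∀ q, eR (Sum.inr (Sum.inl q)) = ρ q := by
  classical
  let R : Finset (Fin n) := Finset.univ.image ρ
  have hR : R.card = b * (b * k) := by
    rw [Finset.card_image_of_injective _ hρ, Finset.card_univ]
    simp only [Fintype.card_prod, Fintype.card_fin]
  have h1 : ∀ r, r ∈ Set.range ρ ↔ r ∈ R := fun r => by simp [R, Set.mem_range]
  let e₁ : (Fin b × Fin b × Fin k) ≃ {r // r ∈ R} :=
    (Equiv.ofInjective ρ hρ).trans (Equiv.subtypeEquivRight h1)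
  have h2 : Fintype.card (Fin b ⊕ Fin m) = Fintype.card {r // r ∉ R} := by
    rw [Fintype.card_subtype_compl, Fintype.card_coe, hR]
    simp only [Fintype.card_sum, Fintype.card_fin]
    omega
  let e₂ := Fintype.equivOfCardEq h2
  let sh : BlockV b k m ≃ (Fin b × Fin b × Fin k) ⊕ (Fin b ⊕ Fin m) :=
    (Equiv.sumAssoc _ _ _).symm.trans
      ((Equiv.sumCongr (Equiv.sumComm _ _) (Equiv.refl _)).trans (Equiv.sumAssoc _ _ _))
  exact ⟨sh.trans ((e₁.sumCongr e₂).trans (Equiv.sumCompl (· ∈ R))), fun q => rfl⟩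

/-- **`stub_greedyRows` — the greedy placement of column mode.**  Let `S` be a set of
`b + b·(b·k)` columns each with more than `b + b·(b·k)` cells in `Y` and more than `b + b·(b·k)`
cells outside `Y`, and `n = b + b·(b·k) + m`.  Then there is a placement `eR eC` of
`G(b,k) ⊕ M₀` whose core and internal column labels lie in `S` and such that for every path
`(i, j)` and every `t + 1 < k` the two cells of the internal column `(i, j, t+1)` in the rows
`(i, j, t)` and `(i, j, t+1)` are split by `Y` (exactly one of them lies in `Y`). [folklore] -/
theorem stub_greedyRows :
    ∀ (b k m n : ℕ) (Y : Finset (Fin n × Fin n)) (S : Finset (Fin n)),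
      S.card = b + b * (b * k) → b + b * (b * k) + m = n →
      (∀ c ∈ S, b + b * (b * k) < (Finset.univ.filter fun r : Fin n => (r, c) ∈ Y).card ∧
        b + b * (b * k) < (Finset.univ.filter fun r : Fin n => (r, c) ∉ Y).card) →
      ∃ eR eC : BlockV b k m ≃ Fin n,
        (∀ i, eC (Sum.inl i) ∈ S) ∧ (∀ p, eC (Sum.inr (Sum.inl p)) ∈ S) ∧
        ∀ (i j : Fin b) (t : ℕ) (ht : t + 1 < k),
          ((eR (Sum.inr (Sum.inl (i, j, ⟨t, Nat.lt_of_succ_lt ht⟩))), eC (Sum.inr (Sum.inl (i, j, ⟨t + 1, ht⟩)))) ∈ Y ↔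
            (eR (Sum.inr (Sum.inl (i, j, ⟨t + 1, ht⟩))), eC (Sum.inr (Sum.inl (i, j, ⟨t + 1, ht⟩)))) ∉ Y) := by
  intro b k m n Y S hS hn hlive
  classical
  obtain ⟨eC, heC₁, heC₂⟩ := exists_blockEquiv S b k m hS (by omega)
  rcases Nat.eq_zero_or_pos n with rfl | hn0
  · have hb : b = 0 := by omega
    subst hb
    exact ⟨eC, eC, heC₁, heC₂, fun i => i.elim0⟩
  haveI : Nonempty (Fin n) := ⟨⟨0, hn0⟩⟩
  -- enumeration of the internal labels: `(i, j, t) ↦ t + k * (j + b * i)`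
  let E : Fin b × Fin b × Fin k ≃ Fin (b * b * k) :=
    (Equiv.prodAssoc _ _ _).symm.trans
      ((Equiv.prodCongr finProdFinEquiv (Equiv.refl _)).trans finProdFinEquiv)
  have hE : ∀ (i j : Fin b) (t : Fin k), (E (i, j, t) : ℕ) = t + k * (j + b * i) := by
    intro i j t
    simp [E]
  have hT : b * b * k ≤ b + b * (b * k) := by rw [Nat.mul_assoc]; omega
  -- the column of an internal label and the good sets
  let C : Fin b × Fin b × Fin k → Fin n := fun q => eC (Sum.inr (Sum.inl q))
  let good : ℕ → Fin n → Finset (Fin n) := fun s a =>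
    if h : s + 1 < b * b * k then
      Finset.univ.filter fun r =>
        ((r, C (E.symm ⟨s + 1, h⟩)) ∈ Y ↔ (a, C (E.symm ⟨s + 1, h⟩)) ∉ Y)
    else Finset.univ
  have hgood : ∀ s, s + 1 < b * b * k → ∀ a, s + 1 < (good s a).card := by
    intro s hs a
    simp only [good, dif_pos hs]
    obtain ⟨h1, h2⟩ := hlive (C (E.symm ⟨s + 1, hs⟩)) (heC₂ _)
    by_cases hac : (a, C (E.symm ⟨s + 1, hs⟩)) ∈ Y
    · simp only [hac, not_true_eq_false, iff_false]
      omega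
    · simp only [hac, not_false_eq_true, iff_true]
      omega
  obtain ⟨f, hinj, hf⟩ :=
    exists_greedySeq good (b * b * k - 1) fun s hs a => hgood s (by omega) a
  -- the internal rows
  let ρ : Fin b × Fin b × Fin k → Fin n := fun q => f (E q)
  have hρ : Function.Injective ρ := by
    intro q q' h
    by_contra hne
    have hne' : (E q : ℕ) ≠ E q' := fun h' => hne (E.injective (Fin.ext h'))
    have hq := (E q).isLt
    have hq' := (E q').isLt
    rcases Nat.lt_or_gt_of_ne hne' with hlt | hlt
    · exact hinj (E q') (by omega) (E q) hlt h
    · exact hinj (E q) (by omega) (E q') hlt h.symm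
  have hsplit : ∀ (i j : Fin b) (t : ℕ) (ht : t + 1 < k),
      (ρ (i, j, ⟨t + 1, ht⟩), C (i, j, ⟨t + 1, ht⟩)) ∈ Y ↔
        (ρ (i, j, ⟨t, Nat.lt_of_succ_lt ht⟩), C (i, j, ⟨t + 1, ht⟩)) ∉ Y := by
    intro i j t ht
    have h1 : (E (i, j, ⟨t, Nat.lt_of_succ_lt ht⟩) : ℕ) = t + k * (j + b * i) := hE _ _ _
    have h2 : (E (i, j, ⟨t + 1, ht⟩) : ℕ) = t + k * (j + b * i) + 1 := by
      rw [hE]; dsimp only; omega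
    have hs1 : t + k * (j + b * i) + 1 < b * b * k := h2 ▸ (E (i, j, ⟨t + 1, ht⟩)).isLt
    have hEs : E.symm ⟨t + k * (j + b * i) + 1, hs1⟩ = (i, j, ⟨t + 1, ht⟩) := by
      rw [Equiv.symm_apply_eq]; exact Fin.ext h2.symm
    have key := hf (t + k * (j + b * i)) (by omega)
    simp only [good, dif_pos hs1, Finset.mem_filter, Finset.mem_univ, true_and, hEs] at key
    show (f (E (i, j, ⟨t + 1, ht⟩)), C (i, j, ⟨t + 1, ht⟩)) ∈ Y ↔
      (f (E (i, j, ⟨t, Nat.lt_of_succ_lt ht⟩)), C (i, j, ⟨t + 1, ht⟩)) ∉ Y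
    rw [h2, h1]
    exact key
  -- the row labelling
  obtain ⟨eR, heR⟩ := exists_blockEquiv_extend ρ hρ hn
  refine ⟨eR, eC, heC₁, heC₂, fun i j t ht => ?_⟩
  rw [heR, heR]
  exact iff_not_comm.1 (hsplit i j t ht)

end Summit.ValiantsHypothesis.ValiantsHypothesis.Theorems.DivisionGapPerDivisionHard
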